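import Summits.CriticalPhenomena.PercolationContinuityZ3.Theorems.PercNearOneGluingNoHeavyLowerTailSuperTerminalQuarticChord
import Mathlib.Analysis.Convex.Jensen
import HarnessLib

/-!
# The MIXTURE PRINCIPLE for the super-terminal quartic law `V4`

Support file for crux `stmt-CriticalPhenomena-4575` (`NoHeavyLowerTail`), seat `prim-facecert` gen 22 (`--supports stmt-CriticalPhenomena-4575`);
memo `run/shared/lean/prim/prim-l12/prim-facecert/FINDING-gen22-PENDANT-PORT-TREE-CLASS.md` §5.  No definitions, no sorries, standard axioms.

* `convexOn_ratio` — the quartic ratio `h(u,v) = (1−u−v)⁴/((1−u)²(1−v)²)` (`= Q⁴/(A²B²)` in port coordinates) is CONVEX on the port triangle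
  `{0 ≤ u < 1, 0 ≤ v < 1, u+v ≤ 1}` (two-point form `SuperTerminalQuarticChord.chord_le`); i.e. the `V4` region `{(u,v,w) : w ≤ 1 − h(u,v)}` is convex.
* `quartic_of_mixture` — **MIXTURE PRINCIPLE**: finitely many port states `(Fᵢ,Qᵢ,Aᵢ,Bᵢ,Cᵢ)` (`0 ≤ Qᵢ ≤ Aᵢ,Bᵢ`, `Aᵢ+Bᵢ = Fᵢ+Qᵢ`, `Aᵢ,Bᵢ > 0`), each
  satisfying `V4`, mixed with weights `λᵢ` (`≥ 0`, sum `1`): if `Cov_λ(F, C) ≤ 0` (equivalently `F` and the attachment probability `w = 1 − C` are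
  positively correlated), the mixture satisfies `V4`.  Proof: the mixture's normal-form point is the convex combination of the normalised states with the
  `F`-TILTED weights `λᵢFᵢ/F̄`; Jensen (`ConvexOn.map_sum_le`) and the covariance step `Σ λᵢFᵢCᵢ/F̄ ≤ Σ λᵢCᵢ`.
Use: any conditioning `Z` of bond percolation under which `V4` holds pointwise (`Z` = a pendant pair: `…QuarticPendant`; `Z` = any pair with
`∂μ(F)/∂w ≥ 0`: `…QuarticSegment`; `Z` = a set of pairs on which `μ(F | ·)` is coordinatewise non-decreasing, by Harris) transfers `V4` to the mixture.
The principle alone does not prove `V4` on all graphs (memo §7: the first-layer corner condition fails at W99-type weights).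
-/

namespace Summit.CriticalPhenomena.PercolationContinuityZ3.Theorems.SuperTerminalQuarticMixture

open Set Finset
open Summit.CriticalPhenomena.PercolationContinuityZ3.Theorems.SuperTerminalQuarticChord

/-- The quartic ratio `h(u,v) = (1−u−v)⁴/((1−u)²(1−v)²)` is convex on the port triangle without its two far corners
`K = {(u,v) : 0 ≤ u < 1, 0 ≤ v < 1, u + v ≤ 1}` (two-point form = `chord_le`). [this work] -/
theorem convexOn_ratio :
    ConvexOn ℝ {p : ℝ × ℝ | 0 ≤ p.1 ∧ p.1 < 1 ∧ 0 ≤ p.2 ∧ p.2 < 1 ∧ p.1 + p.2 ≤ 1}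
      (fun p : ℝ × ℝ => (1 - p.1 - p.2) ^ 4 / ((1 - p.1) ^ 2 * (1 - p.2) ^ 2)) := by
  refine ⟨?_, ?_⟩
  · intro x hx y hy a b ha hb hab
    simp only [mem_setOf_eq, Prod.fst_add, Prod.snd_add, Prod.smul_fst, Prod.smul_snd, smul_eq_mul] at hx hy ⊢
    refine ⟨by nlinarith, ?_, by nlinarith, ?_, by nlinarith⟩
    · rcases le_or_gt a (1/2) with h | h
      · nlinarith [mul_nonneg ha (sub_nonneg.2 hx.2.1.le)]
      · nlinarith [mul_nonneg hb (sub_nonneg.2 hy.2.1.le)]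
    · rcases le_or_gt a (1/2) with h | h
      · nlinarith [mul_nonneg ha (sub_nonneg.2 hx.2.2.2.1.le)]
      · nlinarith [mul_nonneg hb (sub_nonneg.2 hy.2.2.2.1.le)]
  · intro x hx y hy a b ha hb hab
    simp only [mem_setOf_eq] at hx hy
    have hb1 : b ≤ 1 := by linarith
    have key := chord_le (1 - x.1 - x.2) (1 - x.1) (1 - x.2) (1 - y.1 - y.2) (1 - y.1) (1 - y.2)
      (by linarith) (by linarith) (by linarith) (by linarith) (by linarith) (by linarith) (by linarith) (by linarith)
      (by ring) hb hb1
    have ha' : a = 1 - b := by linarith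
    subst ha'
    simp only [Prod.fst_add, Prod.snd_add, Prod.smul_fst, Prod.smul_snd, smul_eq_mul]
    have e1 : 1 - ((1 - b) * x.1 + b * y.1) - ((1 - b) * x.2 + b * y.2) = (1 - x.1 - x.2) + b * ((1 - y.1 - y.2) - (1 - x.1 - x.2)) := by ring
    have e2 : 1 - ((1 - b) * x.1 + b * y.1) = (1 - x.1) + b * ((1 - y.1) - (1 - x.1)) := by ring
    have e3 : 1 - ((1 - b) * x.2 + b * y.2) = (1 - x.2) + b * ((1 - y.2) - (1 - x.2)) := by ring
    rw [e1, e2, e3]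
    exact key

/-- A convex combination (weights `λᵢ ≥ 0`, `Σλᵢ = 1`) of positive numbers is positive. [folklore] -/
theorem sum_mul_pos {ι : Type*} (S : Finset ι) (lam X : ι → ℝ) (hlam : ∀ i ∈ S, 0 ≤ lam i) (hsum : ∑ i ∈ S, lam i = 1)
    (hX : ∀ i ∈ S, 0 < X i) : 0 < ∑ i ∈ S, lam i * X i := by
  by_contra h
  push Not at h
  have hnn : ∀ i ∈ S, 0 ≤ lam i * X i := fun i hi => mul_nonneg (hlam i hi) (hX i hi).le
  have h0 : ∑ i ∈ S, lam i * X i = 0 := le_antisymm h (Finset.sum_nonneg hnn)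
  have hall := (Finset.sum_eq_zero_iff_of_nonneg hnn).1 h0
  have hlam0 : ∀ i ∈ S, lam i = 0 := fun i hi => by
    have := hall i hi
    rcases mul_eq_zero.1 this with h1 | h1
    · exact h1
    · exact absurd h1 (hX i hi).ne'
  have : ∑ i ∈ S, lam i = 0 := Finset.sum_eq_zero hlam0
  linarith

/-- **MIXTURE PRINCIPLE (finite form).**  States `i ∈ S` with weights `λᵢ ≥ 0`, `Σᵢ λᵢ = 1`, and port data `(Fᵢ, Qᵢ, Aᵢ, Bᵢ, Cᵢ)` with
`0 ≤ Qᵢ ≤ Aᵢ, Bᵢ`, `Aᵢ + Bᵢ = Fᵢ + Qᵢ`, `Aᵢ, Bᵢ > 0`, each satisfying `V4ᵢ : Qᵢ⁴ ≤ Aᵢ²Bᵢ²Cᵢ`.  If `F` and `C` are NEGATIVELY correlated under `λ`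
(`Σλᵢ Fᵢ · Σλᵢ Cᵢ ≤ Σλᵢ FᵢCᵢ` reversed: hypothesis `hcov`, i.e. `Cov_λ(F, 1 − C) ≥ 0` — "`F` and the port's attachment probability `w = 1 − C` are
positively correlated"), then the mixture `(ΣλᵢQᵢ, ΣλᵢAᵢ, ΣλᵢBᵢ, ΣλᵢCᵢ)` satisfies `V4`.  Proof: in normal form the mixture point is the convex combination of
the normalised states with the `F`-TILTED weights `λᵢFᵢ/F̄`; Jensen for the convex ratio (`convexOn_ratio`) and the covariance step. [this work] -/
theorem quartic_of_mixture {ι : Type*} (S : Finset ι) (lam F Q A B C : ι → ℝ)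
    (hlam : ∀ i ∈ S, 0 ≤ lam i) (hsum : ∑ i ∈ S, lam i = 1)
    (hQ : ∀ i ∈ S, 0 ≤ Q i) (hQA : ∀ i ∈ S, Q i ≤ A i) (hQB : ∀ i ∈ S, Q i ≤ B i)
    (hs : ∀ i ∈ S, A i + B i = F i + Q i) (hA : ∀ i ∈ S, 0 < A i) (hB : ∀ i ∈ S, 0 < B i)
    (hV : ∀ i ∈ S, Q i ^ 4 ≤ A i ^ 2 * B i ^ 2 * C i)
    (hcov : (∑ i ∈ S, lam i * F i) * (∑ i ∈ S, lam i * C i) ≥ ∑ i ∈ S, lam i * (F i * C i)) :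
    (∑ i ∈ S, lam i * Q i) ^ 4 ≤
      (∑ i ∈ S, lam i * A i) ^ 2 * (∑ i ∈ S, lam i * B i) ^ 2 * (∑ i ∈ S, lam i * C i) := by
  have hF : ∀ i ∈ S, 0 < F i := fun i hi => by have := hs i hi; have := hQB i hi; linarith [hA i hi]
  have hAF : ∀ i ∈ S, A i ≤ F i := fun i hi => by linarith [hs i hi, hQB i hi]
  have hBF : ∀ i ∈ S, B i ≤ F i := fun i hi => by linarith [hs i hi, hQA i hi]
  have hFb := sum_mul_pos S lam F hlam hsum hF
  have hAb := sum_mul_pos S lam A hlam hsum hA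
  have hBb := sum_mul_pos S lam B hlam hsum hB
  set Fb := ∑ i ∈ S, lam i * F i with hFbdef
  -- tilted weights and normalised points
  set wt : ι → ℝ := fun i => lam i * F i / Fb with hwt
  set pt : ι → ℝ × ℝ := fun i => (1 - A i / F i, 1 - B i / F i) with hpt
  have hwt0 : ∀ i ∈ S, 0 ≤ wt i := fun i hi => by simp only [hwt]; exact div_nonneg (mul_nonneg (hlam i hi) (hF i hi).le) hFb.le
  have hwt1 : ∑ i ∈ S, wt i = 1 := by
    simp only [hwt]; rw [← Finset.sum_div]; exact div_self hFb.ne'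
  have hmem : ∀ i ∈ S, pt i ∈ {p : ℝ × ℝ | 0 ≤ p.1 ∧ p.1 < 1 ∧ 0 ≤ p.2 ∧ p.2 < 1 ∧ p.1 + p.2 ≤ 1} := by
    intro i hi
    simp only [hpt, mem_setOf_eq]
    have hFi := hF i hi
    refine ⟨?_, ?_, ?_, ?_, ?_⟩
    · rw [sub_nonneg, div_le_one hFi]; exact hAF i hi
    · have : 0 < A i / F i := div_pos (hA i hi) hFi
      linarith
    · rw [sub_nonneg, div_le_one hFi]; exact hBF i hi
    · have : 0 < B i / F i := div_pos (hB i hi) hFi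
      linarith
    · have : Q i / F i = A i / F i + B i / F i - 1 := by
        field_simp; linarith [hs i hi]
      have hq : 0 ≤ Q i / F i := div_nonneg (hQ i hi) hFi.le
      linarith
  have jensen := convexOn_ratio.map_sum_le hwt0 hwt1 hmem
  -- the mixture point
  have efst : (∑ i ∈ S, wt i • pt i).1 = 1 - (∑ i ∈ S, lam i * A i) / Fb := by
    rw [Prod.fst_sum]
    simp only [Prod.smul_fst, smul_eq_mul, hwt, hpt]
    have : ∀ i ∈ S, lam i * F i / Fb * (1 - A i / F i) = lam i * F i / Fb - lam i * A i / Fb := by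
      intro i hi; field_simp [(hF i hi).ne']
    rw [Finset.sum_congr rfl this, Finset.sum_sub_distrib, ← Finset.sum_div, ← Finset.sum_div, div_self hFb.ne']
  have esnd : (∑ i ∈ S, wt i • pt i).2 = 1 - (∑ i ∈ S, lam i * B i) / Fb := by
    rw [Prod.snd_sum]
    simp only [Prod.smul_snd, smul_eq_mul, hwt, hpt]
    have : ∀ i ∈ S, lam i * F i / Fb * (1 - B i / F i) = lam i * F i / Fb - lam i * B i / Fb := by
      intro i hi; field_simp [(hF i hi).ne']
    rw [Finset.sum_congr rfl this, Finset.sum_sub_distrib, ← Finset.sum_div, ← Finset.sum_div, div_self hFb.ne']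
  -- value of the ratio at the mixture point
  have hQb : ∑ i ∈ S, lam i * Q i = (∑ i ∈ S, lam i * A i) + (∑ i ∈ S, lam i * B i) - Fb := by
    rw [hFbdef, ← Finset.sum_add_distrib, ← Finset.sum_sub_distrib]
    refine Finset.sum_congr rfl fun i hi => ?_
    have := hs i hi
    rw [← mul_add, ← mul_sub]; congr 1; linarith
  have lhs_eq : (fun p : ℝ × ℝ => (1 - p.1 - p.2) ^ 4 / ((1 - p.1) ^ 2 * (1 - p.2) ^ 2)) (∑ i ∈ S, wt i • pt i) =
      (∑ i ∈ S, lam i * Q i) ^ 4 / ((∑ i ∈ S, lam i * A i) ^ 2 * (∑ i ∈ S, lam i * B i) ^ 2) := by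
    have e1 : 1 - (∑ i ∈ S, wt i • pt i).1 - (∑ i ∈ S, wt i • pt i).2 = (∑ i ∈ S, lam i * Q i) / Fb := by
      rw [efst, esnd, hQb]; field_simp; ring
    have e2 : 1 - (∑ i ∈ S, wt i • pt i).1 = (∑ i ∈ S, lam i * A i) / Fb := by rw [efst]; ring
    have e3 : 1 - (∑ i ∈ S, wt i • pt i).2 = (∑ i ∈ S, lam i * B i) / Fb := by rw [esnd]; ring
    show (1 - (∑ i ∈ S, wt i • pt i).1 - (∑ i ∈ S, wt i • pt i).2) ^ 4 /
        ((1 - (∑ i ∈ S, wt i • pt i).1) ^ 2 * (1 - (∑ i ∈ S, wt i • pt i).2) ^ 2) = _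
    rw [e1, e2, e3]
    exact ratio_div _ _ _ _ hFb.ne' hAb.ne' hBb.ne'
  -- value at the states and the covariance step
  have rhs_le : ∑ i ∈ S, wt i • (fun p : ℝ × ℝ => (1 - p.1 - p.2) ^ 4 / ((1 - p.1) ^ 2 * (1 - p.2) ^ 2)) (pt i) ≤
      ∑ i ∈ S, lam i * C i := by
    have step1 : ∀ i ∈ S, wt i • (fun p : ℝ × ℝ => (1 - p.1 - p.2) ^ 4 / ((1 - p.1) ^ 2 * (1 - p.2) ^ 2)) (pt i) ≤
        wt i * C i := by
      intro i hi
      simp only [smul_eq_mul, hpt]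
      have hFi := (hF i hi).ne'
      have e1 : 1 - (1 - A i / F i) - (1 - B i / F i) = Q i / F i := by field_simp; linarith [hs i hi]
      have e2 : 1 - (1 - A i / F i) = A i / F i := by ring
      have e3 : 1 - (1 - B i / F i) = B i / F i := by ring
      rw [e1, e2, e3, ratio_div _ _ _ _ hFi (hA i hi).ne' (hB i hi).ne']
      refine mul_le_mul_of_nonneg_left ?_ (hwt0 i hi)
      rw [div_le_iff₀ (by have := hA i hi; have := hB i hi; positivity)]
      linarith [hV i hi]
    calc _ ≤ ∑ i ∈ S, wt i * C i := Finset.sum_le_sum step1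
      _ = (∑ i ∈ S, lam i * (F i * C i)) / Fb := by
          rw [Finset.sum_div]; refine Finset.sum_congr rfl fun i hi => ?_; simp only [hwt]; ring
      _ ≤ ∑ i ∈ S, lam i * C i := by
          rw [div_le_iff₀ hFb]; nlinarith [hcov]
  have key : (∑ i ∈ S, lam i * Q i) ^ 4 / ((∑ i ∈ S, lam i * A i) ^ 2 * (∑ i ∈ S, lam i * B i) ^ 2) ≤ ∑ i ∈ S, lam i * C i := by
    rw [← lhs_eq]; exact le_trans jensen rhs_le
  rw [div_le_iff₀ (by positivity)] at key
  linarith [key]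

end Summit.CriticalPhenomena.PercolationContinuityZ3.Theorems.SuperTerminalQuarticMixture
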